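import Literature.MathematicalPhysics.QuantumFieldTheory.Balaban1983to89.B9Cor35CDirCubeNoLegHyp
import Literature.MathematicalPhysics.QuantumFieldTheory.Balaban1983to89.B9Cor35PDirCubeNoLegHyp
import Literature.MathematicalPhysics.QuantumFieldTheory.Balaban1983to89.B9Eq359KnitCubeQDiffAtOne
import Literature.MathematicalPhysics.QuantumFieldTheory.Balaban1983to89.B9Cor36GpDirExtAtField

/-!
# `Balaban1983to89.B9Cor36CDirPDirAtField` — [Balaban1985BackgroundPropagators] COROLLARY 3.6 p. 408 AT ONE COVER CUBE FOR PRINT's DIRICHLET THIRD LETTER `C_□`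
# AND PROJECTION LETTER `𝒫_□` (p. 409 l. 1–5): ROAD (I)'s end products `cor35_CDir_cube₀` (Thm 3.2 for `C_□(Ṽ)`) and `hPP_dirC_cube₀` ((3.77) for
# `D_Ṽ𝒫_□(Ṽ)D*_Ṽ − D₁𝒫_□(1)D*₁`) WITH EVERY `A`-DEPENDENT HYPOTHESIS SUPPLIED FROM A (3.35) DATUM — n06-a's `gpDir_cube_at_field` pattern (UNIT 5 readings, n06-l's
# (3.58)–(3.59) kernel sizes) plus FILE `B9Eq359KnitCubeQDiffAtOne` (the pointwise (3.59) sizes of the knit-cube averaging letters) (ROAD (I) U6h; seat dag-n06-c g33)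

statement-level skeleton of published theorems with citation tags; proofs where landed; nothing here is a claim about the Yang–Mills mass gap

## What this file does (mathematically)

[Balaban1985BackgroundPropagators] Cor. 3.6 p. 408: «the operators constructed for this sequence … satisfy all the inequalities of Theorems 3.1–3.3» at
`U = u(U′U)u⁻¹`; Cor. 3.5 p. 407 puts the Sect.-B step at `U = 1` with the small field `U′`; p. 408 («Ω₀(□) ⊂ □⁵ ⊂ □̃», a (3.35) cube).  For a (3.35) datum
`A` on a V1 set `Q` containing the chart preimage of `Ω₀(□)` (`‖A‖ ≤ Cξ⁻¹`, `‖η⁻¹∂A‖ ≤ Cξ⁻²` on `Q`), a datum scale `η ≤ ξ`, `L^{n+1}η ≤ Λξ`, the 2-step stencil of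
the positive-level sites inside `Ω₀(□)`, `α₁ := 2CΛ²` below Theorem 3.4's thresholds and in p06's window for the knit legs, ★★★ `cdir_pdir_cube_at_field`:
(i) the padded compression of def-Y's block word at `Ṽ = e^{iηÃ}·1`, `Ã = cutFldS Ω₀(□) A`, to the blocks inside `Ω₀(□)` is a UNIT and `CinvR b i □ Ṽ` has the
Theorem-3.2 majorant `B·ℓ(a)^{−4}·e^{−δ_C d}` over `(toB6 (geoCK i □) Rr H, val ∘ fst)`; (ii) `conj b((D_Ṽ𝒫_□(Ṽ)D*_Ṽ − D₁𝒫_□(1)D*₁)^ℝ)` has the (3.77)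
majorant `K·α₁·ℓ(a)⁻²·e^{−δ_P d}` over `(toB6 (geoCK i □) Rr H, blkBK i □)`.  All constants depend on `d, L, M₂` only.

## Status

Printed-statement pass + proof body (proof-backed; assembly after n06-a): [Balaban1985BackgroundPropagators] Cor. 3.6 p. 408, Cor. 3.5 p. 407, (3.35)–(3.37) p. 396,
(3.57)–(3.59) pp. 401–402, Thm 3.2 p. 398, (3.76)–(3.77) pp. 405–406, p. 409, re-read 2026-08-31.  Honest label: the Dirichlet `C_□ ∕ 𝒫_□` estimates at ONE cube
from a DISPLAYED (3.35) datum box (its supply from the member's `Reg335` class and the gauge `Ṽ ↦ Uᵘ` re-entry are other seats' units, as for n06-a's `G′_□`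
package); matrix algebras `𝔸 = M_N(ℂ)`.  Node N06 of the `pub-ymgap` DAG is NOT discharged here and the Yang–Mills mass gap is NOT proved here.  NEW file; nothing
landed is modified.  No `sorry`, no `axiom`, no `instance`, no `notation`.  Net new unproved facts: 0.  Cell `pub-ymgap` (HUMAN RULING D-0062), node N06 [B9], seat
`pub-ymgap-dag-n06-c` (g33), 2026-08-31.
RELATED, NOT DUPLICATED (searched 2026-08-31: `rg 'cdir_pdir_cube_at_field'` = ∅): n06-a `B9Cor36GpDirExtAtField.gpDir_cube_at_field` (the `G′_□` package; its
prologue is COPIED here for the readings), ROAD (I) files U6f∕U6g (USED BY NAME).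
-/

noncomputable section

namespace Literature.MathematicalPhysics.QuantumFieldTheory.Balaban1983to89.B9Cor36CDirPDirAtField

open B6RandomWalk (HasMajorant hasMajorant_mono)
open B9Thm34Ext (toB6)
open B9Eq352DivFormLetters (conj)
open B9Eq39Adjoint (fluct covD covDstar)
open B9Eq352DivForm (tauB)
open B6KLevelCensusIndexV1 (KIdx kGeo)
open B6Cover236MultiLevelBlocks (cubes)
open B6GlobalChartV1 (PV boxEquiv)
open B6Geom246MultiLevelBoxL0 (blkOf)
open B9BackgroundsKLevelV1 (shiftsV1)
open B9Eq360DeltaPrimeAY (mulY AfldY chartA)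
open B9Eq360DeltaPrimeACubeY (blkCubeY kFCubeY sFCubeY levCubeY_eq)
open B9CubeLettersOpsL0 (oddMh cubeFamY levCubeY)
open B9CubeLettersBondOpsL0 (BlkCubeY)
open B9CubeGeometryInputs (geoCK geoCK_len geoCK_eta geoCK_eta_pos geoCK_len_blkCubeY RM1)
open B9Cor35GpDirInputsAtOne (dirDomY)
open B9Cor35GCubeInputsAtOne (blkBK)
open B9Cor36CubeCutoffs (scaleLen_levCubeY_bounds)
open B9Eq359CubeKernelsAtOne (ownLevel_of_blockwise)
open B9Eq359CubeKernelsKnitAtOne (CqK CqK_nonneg norm_kFCubeY_parKnitCubeY_one_le norm_sFCubeY_parKnitCubeY_one_le)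
open B9Eq359KnitCubeQDiffAtOne (hF_parKnitCubeY hFs_parKnitCubeY)
open B9Eq337CutFieldDirY (cutFldS cutCfgS readings337_cutFldS)
open B9Cor36GpDirExtAtField (one_le_levCubeY_of_eta_lt)
open B9CubeSequence408Mirrors (mem_dirDomC_of_lev_pos)
open B9Cor35CDirCarrierAtOne (SBlk CinvR)
open B9Cor35CDirCubeNoLegHyp (cor35_CDir_cube₀)
open B9Cor35PDirCubeNoLegHyp (hPP_dirC_cube₀)
open B7Prop2Explicit (C0 c2')
open B7Prop3Flat (c3)
open Node00 (SiteY CfgY toKT shiftY gradY divY)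
open Node00.OpsYLocalInverse (dirPadY)
open Node00.OpsYCubeDirInverse (GpDirY)
open Node00.OpsYCubeDirInverseBond (indProjY)
open Node00.OpsYCubeKnitPar (parKnitCubeY)
open Node00.OpsYCubeProjectionG (XCubeGY PCubeDY)
open scoped Matrix

variable {d ℓ : ℕ} {hd : 1 ≤ d + 1} {hL : Odd (ℓ + 1) ∧ 1 < ℓ + 1} {b₀ b₁ : ℝ}

section AtDatum

open scoped Matrix.Norms.L2Operator

variable {N : ℕ} [Nonempty (Fin N)]
variable {ι : Type} [Fintype ι] [DecidableEq ι] (b : Module.Basis ι ℝ (Matrix (Fin N) (Fin N) ℂ))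

set_option maxRecDepth 16384 in
/-- ★★★ **COROLLARY 3.6 AT ONE COVER CUBE FOR PRINT's DIRICHLET `C_□` AND `𝒫_□` — ROAD (I)'s END PRODUCTS FROM A (3.35) DATUM** (see the module doc).
[cite: Balaban1985BackgroundPropagators, Cor. 3.6 p.408, Cor. 3.5 p.407, Thm 3.2 (3.48) p.398, (3.76)–(3.77) pp.405–406, (3.35)–(3.37) p.396, (3.57)–(3.59) pp.401–402, p.408 («Ω₀(□) ⊂ □⁵»), p.409 l.1–5] -/
theorem cdir_pdir_cube_at_field (d ℓ : ℕ) (hℓ : 1 ≤ ℓ) (M₂ : ℝ) (hM₂ : 0 ≤ M₂) (hrepr : ∀ (v : Matrix (Fin N) (Fin N) ℂ) (j : ι), |b.repr v j| ≤ M₂ * ‖v‖) :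
    ∃ δC δP B K M₀ T₀ : ℝ, ∃ N₀ : ℕ, 0 < δC ∧ 0 < δP ∧ 0 < B ∧ 0 ≤ K ∧ ∃ a₁ : ℝ, 0 < a₁ ∧
    ∀ {hd : 1 ≤ d + 1} {hL : Odd (ℓ + 1) ∧ 1 < ℓ + 1} {b₀ b₁ : ℝ} (i : KIdx d ℓ hd hL b₀ b₁) (c : ↥(cubes (toKT i).D.toDomains)) (Rr : ℝ) (H : Prop),
      M₀ ≤ ((ℓ : ℝ) + 1) * (toKT i).Mh → N₀ + 1 ≤ (toKT i).R * ((ℓ + 1) * (toKT i).Mh) → T₀ ≤ RM1 i →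
    ∀ (A : AfldY (Matrix (Fin N) (Fin N) ℂ) i) (Q : Set (Site (PV d ℓ i.m i.K hd hL) 0)) (C ξ Λ α₀' : ℝ),
      0 ≤ C → (kGeo i).eta ≤ ξ → 1 ≤ Λ → LatticeNorms.scaleLen ((ℓ : ℝ) + 1) (kGeo i).eta (c.1.1 + 1) ≤ Λ * ξ →
      (∀ z ∈ dirDomY i c, (boxEquiv i.hN).symm z ∈ Q) →
      (∀ κ, ∀ x ∈ Q, ‖A κ x‖ ≤ C * ξ⁻¹) →
      (∀ μ ν, ∀ x ∈ Q, ‖(((kGeo i).eta : ℂ)⁻¹) • covD (shiftsV1 (PV d ℓ i.m i.K hd hL)) (fun _ _ => (1 : (Matrix (Fin N) (Fin N) ℂ)ˣ)) μ (A ν) x‖ ≤ C * (ξ ^ 2)⁻¹) →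
      (∀ z : SiteY i, 1 ≤ levCubeY i c z → z ∈ dirDomY i c ∧ ∀ μ, shiftY i μ z ∈ dirDomY i c ∧ (shiftY i μ).symm z ∈ dirDomY i c ∧
        ∀ ν, shiftY i ν (shiftY i μ z) ∈ dirDomY i c ∧ shiftY i ν ((shiftY i μ).symm z) ∈ dirDomY i c ∧ (shiftY i ν).symm ((shiftY i μ).symm z) ∈ dirDomY i c) →
      2 * C * Λ ^ 2 ≤ a₁ →
      0 < α₀' → C0 (d + 1) * α₀' ≤ 1 / 3 → 4 * α₀' ≤ c2' (d + 1) (ℓ + 1) →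
      Real.exp (4 * (800 * (((d + 1 : ℕ) : ℝ) + 1) ^ 2 * (((d + 1 : ℕ) : ℝ) + 4)) * α₀') * (1 + 8 * (131072 * (((d + 1 : ℕ) : ℝ) + 1) ^ 2) * (2 * C * Λ ^ 2)) ≤ 2 →
      2 * (2 * C * Λ ^ 2) ≤ c3 (d + 1) (ℓ + 1) → 4096 * ((d + 1 : ℕ) : ℝ) * (2 * C * Λ ^ 2) ≤ 1 →
      (IsUnit (dirPadY (indProjY (SBlk i c))
          (XCubeGY i c (parKnitCubeY i c) (GpDirY i c (parKnitCubeY i c) (dirDomY i c)) (cutCfgS i (dirDomY i c) (kGeo i).eta A))) ∧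
        HasMajorant (g := toB6 (geoCK i c) Rr H) (fun q : ↥(SBlk i c) × ι => (q.1 : BlkCubeY i c)) (CinvR b i c (cutCfgS i (dirDomY i c) (kGeo i).eta A))
          (fun a a' => B * (geoCK i c).len a ^ (-(4 : ℝ)) * Real.exp (-(δC * (geoCK i c).dist a a')))) ∧
      HasMajorant (g := toB6 (geoCK i c) Rr H) (blkBK i c)
        (conj b ((gradY i (cutCfgS i (dirDomY i c) (kGeo i).eta A) ∘ₗ
            PCubeDY i c (parKnitCubeY i c) (GpDirY i c (parKnitCubeY i c) (dirDomY i c)) (SBlk i c) (cutCfgS i (dirDomY i c) (kGeo i).eta A) ∘ₗ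
            divY i (cutCfgS i (dirDomY i c) (kGeo i).eta A) -
          gradY i (fun _ _ => 1) ∘ₗ PCubeDY i c (parKnitCubeY i c) (GpDirY i c (parKnitCubeY i c) (dirDomY i c)) (SBlk i c) (fun _ _ => 1) ∘ₗ
            divY i (fun _ _ => 1)).restrictScalars ℝ))
        (fun a a' => K * (2 * C * Λ ^ 2) * ((geoCK i c).len a ^ 2)⁻¹ * Real.exp (-(δP * (geoCK i c).dist a a'))) := by
  letI : CStarAlgebra (Matrix (Fin N) (Fin N) ℂ) := {}
  have h1A : ‖(1 : Matrix (Fin N) (Fin N) ℂ)‖ ≤ 1 := norm_one.le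
  obtain ⟨δC, B, M₀, T₀, N₀, hδC, hB, a₁, ha₁, HC⟩ := cor35_CDir_cube₀ b d ℓ hℓ (CqK d) M₂ (CqK_nonneg d) hM₂ hrepr h1A
  obtain ⟨δP, M₀', T₀', N₀', hδP, a₁', ha₁', K, hK, HP⟩ := hPP_dirC_cube₀ b d ℓ hℓ (CqK d) M₂ (CqK_nonneg d) hM₂ hrepr h1A
  refine ⟨δC, δP, B, K, max M₀ M₀', max T₀ T₀', max N₀ N₀', hδC, hδP, hB, hK, min a₁ a₁', lt_min ha₁ ha₁', ?_⟩
  intro hd hL b₀ b₁ i c Rr H hM hN hT A Q C ξ Λ α₀' hC hξ hΛ hΛξ hQ hA hdA hS2 hα₁ hα' hα3 hα4' hsmall hc₃ hsm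
  have hM0 : M₀ ≤ ((ℓ : ℝ) + 1) * (toKT i).Mh := (le_max_left _ _).trans hM
  have hM0' : M₀' ≤ ((ℓ : ℝ) + 1) * (toKT i).Mh := (le_max_right _ _).trans hM
  have hN0 : N₀ + 1 ≤ (toKT i).R * ((ℓ + 1) * (toKT i).Mh) := le_trans (Nat.succ_le_succ (le_max_left _ _)) hN
  have hN0' : N₀' + 1 ≤ (toKT i).R * ((ℓ + 1) * (toKT i).Mh) := le_trans (Nat.succ_le_succ (le_max_right _ _)) hN
  have hT0 : T₀ ≤ RM1 i := (le_max_left _ _).trans hT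
  have hT0' : T₀' ≤ RM1 i := (le_max_right _ _).trans hT
  set η : ℝ := (kGeo i).eta with hηdef
  have hη : 0 < η := by rw [hηdef, ← geoCK_eta i c]; exact geoCK_eta_pos i c
  set α₁ : ℝ := 2 * C * Λ ^ 2 with hα₁def
  have hα₁0 : 0 ≤ α₁ := by rw [hα₁def]; positivity
  -- the length function of the engines at the cube blocks is `L^{n(z)}η` (n06-a's prologue)
  have hL1 : (1 : ℝ) ≤ (ℓ : ℝ) + 1 := by linarith [(Nat.cast_nonneg ℓ : (0 : ℝ) ≤ ℓ)]
  have hlenS : ∀ z : SiteY i, (geoCK i c).len (blkCubeY i c z) = LatticeNorms.scaleLen ((ℓ : ℝ) + 1) η (levCubeY i c z) := fun z => by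
    rw [(geoCK_len_blkCubeY i c z).1]; rfl
  have hlenη : ∀ z : SiteY i, η ≤ (geoCK i c).len (blkCubeY i c z) := fun z => by
    rw [(geoCK_len_blkCubeY i c z).1]
    exact le_mul_of_one_le_left hη.le (one_le_pow₀ hL1)
  have hlenΛ : ∀ z : SiteY i, (geoCK i c).len (blkCubeY i c z) ≤ Λ * ξ := fun z => by
    rw [hlenS]; exact (scaleLen_levCubeY_bounds i c hL1 hη hΛξ z).2
  have hS2' : ∀ z : SiteY i, η < (geoCK i c).len (blkCubeY i c z) → z ∈ dirDomY i c ∧ ∀ μ, shiftY i μ z ∈ dirDomY i c ∧ (shiftY i μ).symm z ∈ dirDomY i c ∧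
      ∀ ν, shiftY i ν (shiftY i μ z) ∈ dirDomY i c ∧ shiftY i ν ((shiftY i μ).symm z) ∈ dirDomY i c ∧ (shiftY i ν).symm ((shiftY i μ).symm z) ∈ dirDomY i c :=
    fun z hz => hS2 z (one_le_levCubeY_of_eta_lt i c hz)
  -- the five (3.37) readings of the cut potential (UNIT 5)
  obtain ⟨r1, r2, r3, r4, r5⟩ := readings337_cutFldS i hC hη hξ hΛ hQ hA hdA (fun z => (geoCK i c).len (blkCubeY i c z)) hlenη hlenΛ hS2'
  -- the own-level (3.37), the (3.59) kernel sizes (n06-l) and the (3.59) averaging-letter sizes (U6g) at the knit legs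
  have hown := ownLevel_of_blockwise i c hη (cutFldS i (dirDomY i c) A) (α₁ := α₁) (fun k x => by
    have h := r4 k x
    rw [(geoCK_len_blkCubeY i c x).1, levCubeY_eq] at h
    push_cast
    exact h)
  have hkF : ∀ (y : BlkCubeY i c) (x : SiteY i), blkCubeY i c x = y →
      ‖kFCubeY i c (parKnitCubeY i c) (fun _ _ => 1) (cutCfgS i (dirDomY i c) η A) y x‖ ≤ CqK d * α₁ * B9Cor35GpCubeInputsAtOne.wK i c y :=
    fun y x hx => norm_kFCubeY_parKnitCubeY_one_le i c hα' hα3 hα4' hη.le hα₁0 hsmall hc₃ hsm (cutFldS i (dirDomY i c) A) y (hown y) x hx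
  have hsF : ∀ x : SiteY i, ‖sFCubeY i c (parKnitCubeY i c) (fun _ _ => 1) (cutCfgS i (dirDomY i c) η A) x‖ ≤ CqK d * α₁ :=
    fun x => norm_sFCubeY_parKnitCubeY_one_le i c hα' hα3 hα4' hη.le hα₁0 hsmall hc₃ hsm (cutFldS i (dirDomY i c) A) x (hown (blkCubeY i c x))
  have hF := hF_parKnitCubeY i c hα' hα3 hα4' hη.le hα₁0 hsmall hc₃ hsm (cutFldS i (dirDomY i c) A) hown
  have hFs := hFs_parKnitCubeY i c hα' hα3 hα4' hη.le hα₁0 hsmall hc₃ hsm (cutFldS i (dirDomY i c) A) (fun s => hown s)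
  have hFs' : ∀ (z : SiteY i) (nu : BlkCubeY i c → Matrix (Fin N) (Fin N) ℂ),
      ‖(B9CubeLettersBondOpsL0.QpsCubeY i c (parKnitCubeY i c) (cutCfgS i (dirDomY i c) η A) nu -
          B9CubeLettersBondOpsL0.QpsCubeY i c (parKnitCubeY i c) (fun _ _ => 1) nu) z‖ ≤
        CqK d * α₁ * ∑ s, |B9CubeLettersBondOpsL0.qpsKc i c z s| * ‖nu s‖ := fun z nu => hFs z nu
  refine ⟨HC i c Rr H hM0 hN0 hT0 α₁ hα₁0 (hα₁.trans (min_le_left _ _)) A hkF hsF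
      (fun ν k x => by rw [geoCK_eta]; exact r1 ν k x) (fun μ ν x => by rw [geoCK_eta]; exact r2 μ ν x) (fun μ x => by rw [geoCK_eta]; exact r3 μ x)
      r4 r5 hF hFs',
    HP i c Rr H hM0' hN0' hT0' α₁ hα₁0 (hα₁.trans (min_le_right _ _)) A hkF hsF
      (fun ν k x => by rw [geoCK_eta]; exact r1 ν k x) (fun μ ν x => by rw [geoCK_eta]; exact r2 μ ν x) (fun μ x => by rw [geoCK_eta]; exact r3 μ x)
      r4 r5 hF hFs'⟩

end AtDatum

end Literature.MathematicalPhysics.QuantumFieldTheory.Balaban1983to89.B9Cor36CDirPDirAtField
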